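import Literature.NumberTheory.LFunctions.KloostermanFractionsFrom51
import HarnessLib

/-!
# Trilinear forms with Kloosterman fractions: Bettin–Chandee's choice of `L` (§5, general `A`)

Topic `NumberTheory/LFunctions`.  S. Bettin, V. Chandee, *Trilinear forms with Kloosterman
fractions*, Adv. Math. 328 (2018), §5 "Optimizing the parameter `L`": from (5.1),
`𝓒_b ≪ ‖β‖²‖ν‖² M^ε(1+|ϑ|A/(bNM))^{1/2}(AM(bN)^{1/2}L^{-1/2} + AM²/(bLN) + M²/L + b^{3/4}AM^{1/2}N^{5/4}L^{-1/2} + b^{1/2}AL^{3/2}N^{7/4} + b^{1/2}A^{1/2}MN/L)`,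
"We wish to choose `L` so that `b^{1/2}AL^{3/2}N^{7/4} ≈ AM²/(bLN) + M²/L + b^{1/2}A^{1/2}MN/L`
and `L ≥ 2 log(bϑM)`.  So we take
`L = M^{4/5}/(b^{3/5}N^{11/10}) + M^{4/5}/(b^{1/5}A^{2/5}N^{7/10}) + M^{2/5}/(A^{1/5}N^{3/10}) + M^ε`.
With this choice (5.1) implies (5.2)":
`𝓒_b ≪ ‖β‖²‖ν‖² M^ε (1+|ϑ|A/(bNM))^{1/2} (AM(bN)^{1/2} + b^{3/4}AM^{1/2}N^{5/4} + AM^{6/5}N^{1/10}b^{-2/5} + b^{1/5}A^{2/5}M^{6/5}N^{7/10} + A^{7/10}b^{1/2}M^{3/5}N^{13/10} + b^{1/2}AN^{7/4})`.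
This file PROVES the real-variable inequality behind this step for general `A` (the tree's
`BC_optimise_L`, `KloostermanFractionsOptimiseL.lean`, is the case `A = 1`), with the last summand
of `L` an arbitrary `X ≥ 1` at the cost of the factor `X^{3/2}`: `BC_optimise_LA`; and the
§5-layer of the reduction of the named fact `BettinChandee2018_trilinearKloostermanFractions`:
**`BC_CbA_bound_of_LA_bound`** — (5.1) (general `A`, twisted, for every admissible `L`) ⟹ (5.2)
in exactly the shape consumed by `BC_C1A_bound_of_CbA_bound`
(`TrilinearKloostermanFractionsFromCb.lean`); the tree's `BC_Cb_bound_of_L_bound`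
(`KloostermanFractionsFrom51.lean`) is the case `A = 1`.  No new named facts (D-0026).

## References

* S. Bettin, V. Chandee, Adv. Math. 328 (2018) 1234–1262 (arXiv:1502.00769), §5 ((5.1), (5.2)).
  [BettinChandee2018]
-/

noncomputable section

open Real

namespace Literature.NumberTheory.LFunctions

/-- **Bettin–Chandee's choice of `L`, general `A`** (§5): for `M, N, b, A > 0`, `X ≥ 1` and
`L = M^{4/5}b^{-3/5}N^{-11/10} + M^{4/5}b^{-1/5}A^{-2/5}N^{-7/10} + M^{2/5}A^{-1/5}N^{-3/10} + X`,
`AM(bN)^{1/2}L^{-1/2} + AM²/(bLN) + M²/L + b^{3/4}AM^{1/2}N^{5/4}L^{-1/2} + b^{1/2}AL^{3/2}N^{7/4} + b^{1/2}A^{1/2}MN/L`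
`≤ 9 X^{3/2} (AM(bN)^{1/2} + b^{3/4}AM^{1/2}N^{5/4} + AM^{6/5}N^{1/10}b^{-2/5} + b^{1/5}A^{2/5}M^{6/5}N^{7/10} + A^{7/10}b^{1/2}M^{3/5}N^{13/10} + b^{1/2}AN^{7/4})`
(each summand of the left is dominated using `L ≥` one summand of `L`; for the increasing term,
`L^{3/2} ≤ 8 max^{3/2}` over the four summands). [cite: BettinChandee2018, §5] -/
theorem BC_optimise_LA {M N b A X L : ℝ} (hM : 0 < M) (hN : 0 < N) (hb : 0 < b) (hA : 0 < A)
    (hX : 1 ≤ X)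
    (hL : L = M ^ (4 / 5 : ℝ) * b ^ (-(3 / 5) : ℝ) * N ^ (-(11 / 10) : ℝ) +
      M ^ (4 / 5 : ℝ) * b ^ (-(1 / 5) : ℝ) * A ^ (-(2 / 5) : ℝ) * N ^ (-(7 / 10) : ℝ) +
      M ^ (2 / 5 : ℝ) * A ^ (-(1 / 5) : ℝ) * N ^ (-(3 / 10) : ℝ) + X) :
    A * M * (b * N) ^ (1 / 2 : ℝ) * L ^ (-(1 / 2) : ℝ) + A * M ^ 2 / (b * L * N) + M ^ 2 / L +
        b ^ (3 / 4 : ℝ) * A * M ^ (1 / 2 : ℝ) * N ^ (5 / 4 : ℝ) * L ^ (-(1 / 2) : ℝ) +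
        b ^ (1 / 2 : ℝ) * A * L ^ (3 / 2 : ℝ) * N ^ (7 / 4 : ℝ) + b ^ (1 / 2 : ℝ) * A ^ (1 / 2 : ℝ) * M * N / L ≤
      9 * X ^ (3 / 2 : ℝ) * (A * M * (b * N) ^ (1 / 2 : ℝ) +
        b ^ (3 / 4 : ℝ) * A * M ^ (1 / 2 : ℝ) * N ^ (5 / 4 : ℝ) +
        A * M ^ (6 / 5 : ℝ) * N ^ (1 / 10 : ℝ) * b ^ (-(2 / 5) : ℝ) +
        b ^ (1 / 5 : ℝ) * A ^ (2 / 5 : ℝ) * M ^ (6 / 5 : ℝ) * N ^ (7 / 10 : ℝ) +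
        A ^ (7 / 10 : ℝ) * b ^ (1 / 2 : ℝ) * M ^ (3 / 5 : ℝ) * N ^ (13 / 10 : ℝ) +
        b ^ (1 / 2 : ℝ) * A * N ^ (7 / 4 : ℝ)) := by
  have hX0 : 0 < X := by linarith
  -- logarithmic coordinates
  obtain ⟨m, hm⟩ : ∃ m : ℝ, m = Real.log M := ⟨_, rfl⟩
  obtain ⟨n, hn⟩ : ∃ n : ℝ, n = Real.log N := ⟨_, rfl⟩
  obtain ⟨l, hl⟩ : ∃ l : ℝ, l = Real.log b := ⟨_, rfl⟩
  obtain ⟨a, ha⟩ : ∃ a : ℝ, a = Real.log A := ⟨_, rfl⟩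
  have eM : ∀ c : ℝ, M ^ c = Real.exp (c * m) := fun c => by rw [Real.rpow_def_of_pos hM, mul_comm, hm]
  have eN : ∀ c : ℝ, N ^ c = Real.exp (c * n) := fun c => by rw [Real.rpow_def_of_pos hN, mul_comm, hn]
  have eb : ∀ c : ℝ, b ^ c = Real.exp (c * l) := fun c => by rw [Real.rpow_def_of_pos hb, mul_comm, hl]
  have eA : ∀ c : ℝ, A ^ c = Real.exp (c * a) := fun c => by rw [Real.rpow_def_of_pos hA, mul_comm, ha]
  have eM1 : M = Real.exp m := by rw [hm, Real.exp_log hM]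
  have eN1 : N = Real.exp n := by rw [hn, Real.exp_log hN]
  have eb1 : b = Real.exp l := by rw [hl, Real.exp_log hb]
  have eA1 : A = Real.exp a := by rw [ha, Real.exp_log hA]
  have eM2 : M ^ 2 = Real.exp (2 * m) := by
    rw [eM1, ← Real.exp_nat_mul]; norm_num
  -- the summands of `L`, as exponentials
  obtain ⟨t₁, ht₁⟩ : ∃ t : ℝ, t = Real.exp (4 / 5 * m + -(3 / 5) * l + -(11 / 10) * n) := ⟨_, rfl⟩
  obtain ⟨t₂, ht₂⟩ : ∃ t : ℝ, t = Real.exp (4 / 5 * m + -(1 / 5) * l + -(2 / 5) * a + -(7 / 10) * n) :=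
    ⟨_, rfl⟩
  obtain ⟨t₃, ht₃⟩ : ∃ t : ℝ, t = Real.exp (2 / 5 * m + -(1 / 5) * a + -(3 / 10) * n) := ⟨_, rfl⟩
  have ht₁' : M ^ (4 / 5 : ℝ) * b ^ (-(3 / 5) : ℝ) * N ^ (-(11 / 10) : ℝ) = t₁ := by
    rw [ht₁, eM, eb, eN, ← Real.exp_add, ← Real.exp_add]
  have ht₂' : M ^ (4 / 5 : ℝ) * b ^ (-(1 / 5) : ℝ) * A ^ (-(2 / 5) : ℝ) * N ^ (-(7 / 10) : ℝ) = t₂ := by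
    rw [ht₂, eM, eb, eA, eN, ← Real.exp_add, ← Real.exp_add, ← Real.exp_add]
  have ht₃' : M ^ (2 / 5 : ℝ) * A ^ (-(1 / 5) : ℝ) * N ^ (-(3 / 10) : ℝ) = t₃ := by
    rw [ht₃, eM, eA, eN, ← Real.exp_add, ← Real.exp_add]
  have ht₁0 : 0 < t₁ := by rw [ht₁]; exact Real.exp_pos _
  have ht₂0 : 0 < t₂ := by rw [ht₂]; exact Real.exp_pos _
  have ht₃0 : 0 < t₃ := by rw [ht₃]; exact Real.exp_pos _
  rw [ht₁', ht₂', ht₃'] at hL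
  have hL1 : t₁ ≤ L := by rw [hL]; linarith
  have hL2 : t₂ ≤ L := by rw [hL]; linarith
  have hL3 : t₃ ≤ L := by rw [hL]; linarith
  have hLX : X ≤ L := by rw [hL]; linarith
  have hL0 : 0 < L := by linarith
  have hLge1 : 1 ≤ L := hX.trans hLX
  -- the six right-hand terms, as exponentials
  obtain ⟨R₁, hR₁⟩ : ∃ t : ℝ, t = Real.exp (a + m + (1 / 2 * l + 1 / 2 * n)) := ⟨_, rfl⟩
  obtain ⟨R₂, hR₂⟩ : ∃ t : ℝ, t = Real.exp (3 / 4 * l + a + 1 / 2 * m + 5 / 4 * n) := ⟨_, rfl⟩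
  obtain ⟨R₃, hR₃⟩ : ∃ t : ℝ, t = Real.exp (a + 6 / 5 * m + 1 / 10 * n + -(2 / 5) * l) := ⟨_, rfl⟩
  obtain ⟨R₄, hR₄⟩ : ∃ t : ℝ, t = Real.exp (1 / 5 * l + 2 / 5 * a + 6 / 5 * m + 7 / 10 * n) := ⟨_, rfl⟩
  obtain ⟨R₅, hR₅⟩ : ∃ t : ℝ, t = Real.exp (7 / 10 * a + 1 / 2 * l + 3 / 5 * m + 13 / 10 * n) := ⟨_, rfl⟩
  obtain ⟨R₆, hR₆⟩ : ∃ t : ℝ, t = Real.exp (1 / 2 * l + a + 7 / 4 * n) := ⟨_, rfl⟩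
  have hR₁' : A * M * (b * N) ^ (1 / 2 : ℝ) = R₁ := by
    rw [hR₁, Real.mul_rpow hb.le hN.le, eb, eN, eM1, eA1]; simp only [← Real.exp_add]
  have hR₂' : b ^ (3 / 4 : ℝ) * A * M ^ (1 / 2 : ℝ) * N ^ (5 / 4 : ℝ) = R₂ := by
    rw [hR₂, eb, eM, eN, eA1]; simp only [← Real.exp_add]
  have hR₃' : A * M ^ (6 / 5 : ℝ) * N ^ (1 / 10 : ℝ) * b ^ (-(2 / 5) : ℝ) = R₃ := by
    rw [hR₃, eM, eN, eb, eA1]; simp only [← Real.exp_add]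
  have hR₄' : b ^ (1 / 5 : ℝ) * A ^ (2 / 5 : ℝ) * M ^ (6 / 5 : ℝ) * N ^ (7 / 10 : ℝ) = R₄ := by
    rw [hR₄, eb, eA, eM, eN]; simp only [← Real.exp_add]
  have hR₅' : A ^ (7 / 10 : ℝ) * b ^ (1 / 2 : ℝ) * M ^ (3 / 5 : ℝ) * N ^ (13 / 10 : ℝ) = R₅ := by
    rw [hR₅, eA, eb, eM, eN]; simp only [← Real.exp_add]
  have hR₆' : b ^ (1 / 2 : ℝ) * A * N ^ (7 / 4 : ℝ) = R₆ := by
    rw [hR₆, eb, eN, eA1]; simp only [← Real.exp_add]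
  rw [hR₁', hR₂', hR₃', hR₄', hR₅', hR₆']
  have hR₁0 : 0 < R₁ := by rw [hR₁]; exact Real.exp_pos _
  have hR₂0 : 0 < R₂ := by rw [hR₂]; exact Real.exp_pos _
  have hR₃0 : 0 < R₃ := by rw [hR₃]; exact Real.exp_pos _
  have hR₄0 : 0 < R₄ := by rw [hR₄]; exact Real.exp_pos _
  have hR₅0 : 0 < R₅ := by rw [hR₅]; exact Real.exp_pos _
  have hR₆0 : 0 < R₆ := by rw [hR₆]; exact Real.exp_pos _
  have hX32 : 1 ≤ X ^ (3 / 2 : ℝ) := Real.one_le_rpow hX (by norm_num)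
  have hb12 : 0 < b ^ (1 / 2 : ℝ) := by positivity
  -- (1), (4): `L^{-1/2} ≤ 1`
  have hLm12 : L ^ (-(1 / 2) : ℝ) ≤ 1 := by
    rw [Real.rpow_neg hL0.le]
    exact inv_le_one_of_one_le₀ (Real.one_le_rpow hLge1 (by norm_num))
  have b1 : R₁ * L ^ (-(1 / 2) : ℝ) ≤ R₁ := by
    calc R₁ * L ^ (-(1 / 2) : ℝ) ≤ R₁ * 1 := by gcongr
      _ = R₁ := mul_one _
  have b4 : R₂ * L ^ (-(1 / 2) : ℝ) ≤ R₂ := by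
    calc R₂ * L ^ (-(1 / 2) : ℝ) ≤ R₂ * 1 := by gcongr
      _ = R₂ := mul_one _
  -- (2) `AM²/(bLN) ≤ AM²/(b t₁ N) = R₃`
  have b2 : A * M ^ 2 / (b * L * N) ≤ R₃ := by
    have h1 : A * M ^ 2 / (b * L * N) ≤ A * M ^ 2 / (b * t₁ * N) := by
      apply div_le_div_of_nonneg_left (by positivity) (by positivity)
      gcongr
    have h2 : A * M ^ 2 / (b * t₁ * N) = R₃ := by
      rw [div_eq_iff (by positivity), eM2, eb1, eN1, eA1, ht₁, hR₃]
      simp only [← Real.exp_add]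
      congr 1; ring
    exact h1.trans h2.le
  -- (3) `M²/L ≤ M²/t₂ = R₄`
  have b3 : M ^ 2 / L ≤ R₄ := by
    have h1 : M ^ 2 / L ≤ M ^ 2 / t₂ := div_le_div_of_nonneg_left (by positivity) ht₂0 hL2
    have h2 : M ^ 2 / t₂ = R₄ := by
      rw [div_eq_iff ht₂0.ne', eM2, ht₂, hR₄, ← Real.exp_add]
      congr 1; ring
    exact h1.trans h2.le
  -- (6) `b^{1/2} A^{1/2} M N / L ≤ b^{1/2} A^{1/2} M N / t₃ = R₅`
  have b6 : b ^ (1 / 2 : ℝ) * A ^ (1 / 2 : ℝ) * M * N / L ≤ R₅ := by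
    have h1 : b ^ (1 / 2 : ℝ) * A ^ (1 / 2 : ℝ) * M * N / L ≤ b ^ (1 / 2 : ℝ) * A ^ (1 / 2 : ℝ) * M * N / t₃ :=
      div_le_div_of_nonneg_left (by positivity) ht₃0 hL3
    have h2 : b ^ (1 / 2 : ℝ) * A ^ (1 / 2 : ℝ) * M * N / t₃ = R₅ := by
      rw [div_eq_iff ht₃0.ne', eb, eA, eM1, eN1, ht₃, hR₅]
      simp only [← Real.exp_add]
      congr 1; ring
    exact h1.trans h2.le
  -- (5) `b^{1/2} A L^{3/2} N^{7/4} = R₆ L^{3/2} ≤ 8 (R₃ + R₄ + R₅ + X^{3/2} R₆)`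
  have b5 : b ^ (1 / 2 : ℝ) * A * L ^ (3 / 2 : ℝ) * N ^ (7 / 4 : ℝ) ≤
      8 * (R₃ + R₄ + R₅ + X ^ (3 / 2 : ℝ) * R₆) := by
    -- `L ≤ 4 max`, `L^{3/2} ≤ 8 (t₁^{3/2} + t₂^{3/2} + t₃^{3/2} + X^{3/2})`
    obtain ⟨tm, htm⟩ : ∃ t : ℝ, t = max (max t₁ t₂) (max t₃ X) := ⟨_, rfl⟩
    have e1 : t₁ ≤ tm := by rw [htm]; exact (le_max_left t₁ t₂).trans (le_max_left _ _)
    have e2 : t₂ ≤ tm := by rw [htm]; exact (le_max_right t₁ t₂).trans (le_max_left _ _)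
    have e3 : t₃ ≤ tm := by rw [htm]; exact (le_max_left t₃ X).trans (le_max_right _ _)
    have e4 : X ≤ tm := by rw [htm]; exact (le_max_right t₃ X).trans (le_max_right _ _)
    have htm0 : 0 ≤ tm := hX0.le.trans e4
    have hLtm : L ≤ 4 * tm := by rw [hL]; linarith
    have hL32 : L ^ (3 / 2 : ℝ) ≤ 8 * (t₁ ^ (3 / 2 : ℝ) + t₂ ^ (3 / 2 : ℝ) + t₃ ^ (3 / 2 : ℝ) + X ^ (3 / 2 : ℝ)) := by
      have h1 : L ^ (3 / 2 : ℝ) ≤ (4 * tm) ^ (3 / 2 : ℝ) := Real.rpow_le_rpow hL0.le hLtm (by norm_num)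
      have h2 : (4 * tm) ^ (3 / 2 : ℝ) = 8 * tm ^ (3 / 2 : ℝ) := by
        rw [Real.mul_rpow (by norm_num) htm0]
        congr 1
        rw [show (4 : ℝ) = 2 ^ (2 : ℝ) by norm_num, ← Real.rpow_mul (by norm_num),
          show (2 : ℝ) * (3 / 2) = ((3 : ℕ) : ℝ) by norm_num, Real.rpow_natCast]
        norm_num
      have h3 : tm ^ (3 / 2 : ℝ) ≤ t₁ ^ (3 / 2 : ℝ) + t₂ ^ (3 / 2 : ℝ) + t₃ ^ (3 / 2 : ℝ) + X ^ (3 / 2 : ℝ) := by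
        rw [htm]
        calc (max (max t₁ t₂) (max t₃ X)) ^ (3 / 2 : ℝ) ≤ (max t₁ t₂) ^ (3 / 2 : ℝ) + (max t₃ X) ^ (3 / 2 : ℝ) :=
              DFI_max_rpow_le_add _ (le_max_of_le_left ht₁0.le) (le_max_of_le_left ht₃0.le)
          _ ≤ (t₁ ^ (3 / 2 : ℝ) + t₂ ^ (3 / 2 : ℝ)) + (t₃ ^ (3 / 2 : ℝ) + X ^ (3 / 2 : ℝ)) :=
              add_le_add (DFI_max_rpow_le_add _ ht₁0.le ht₂0.le) (DFI_max_rpow_le_add _ ht₃0.le hX0.le)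
          _ = _ := by ring
      calc L ^ (3 / 2 : ℝ) ≤ 8 * tm ^ (3 / 2 : ℝ) := h1.trans h2.le
        _ ≤ _ := by linarith
    -- the monomial identities `R₆ tᵢ^{3/2} = R₃, R₄, R₅`
    have i1 : R₆ * t₁ ^ (3 / 2 : ℝ) = R₃ := by
      rw [ht₁, ← Real.exp_mul, hR₆, hR₃, ← Real.exp_add]; congr 1; ring
    have i2 : R₆ * t₂ ^ (3 / 2 : ℝ) = R₄ := by
      rw [ht₂, ← Real.exp_mul, hR₆, hR₄, ← Real.exp_add]; congr 1; ring
    have i3 : R₆ * t₃ ^ (3 / 2 : ℝ) = R₅ := by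
      rw [ht₃, ← Real.exp_mul, hR₆, hR₅, ← Real.exp_add]; congr 1; ring
    have hbN : b ^ (1 / 2 : ℝ) * A * N ^ (7 / 4 : ℝ) = R₆ := hR₆'
    calc b ^ (1 / 2 : ℝ) * A * L ^ (3 / 2 : ℝ) * N ^ (7 / 4 : ℝ)
        = (b ^ (1 / 2 : ℝ) * A * N ^ (7 / 4 : ℝ)) * L ^ (3 / 2 : ℝ) := by ring
      _ = R₆ * L ^ (3 / 2 : ℝ) := by rw [hbN]
      _ ≤ R₆ * (8 * (t₁ ^ (3 / 2 : ℝ) + t₂ ^ (3 / 2 : ℝ) + t₃ ^ (3 / 2 : ℝ) + X ^ (3 / 2 : ℝ))) :=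
          mul_le_mul_of_nonneg_left hL32 hR₆0.le
      _ = 8 * (R₆ * t₁ ^ (3 / 2 : ℝ) + R₆ * t₂ ^ (3 / 2 : ℝ) + R₆ * t₃ ^ (3 / 2 : ℝ) + X ^ (3 / 2 : ℝ) * R₆) := by
          ring
      _ = 8 * (R₃ + R₄ + R₅ + X ^ (3 / 2 : ℝ) * R₆) := by rw [i1, i2, i3]
  -- assemble
  have g : ∀ {R : ℝ}, 0 ≤ R → R ≤ X ^ (3 / 2 : ℝ) * R := fun hR => le_mul_of_one_le_left hR hX32
  have g1 := g hR₁0.le; have g2 := g hR₂0.le; have g3 := g hR₃0.le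
  have g4 := g hR₄0.le; have g5 := g hR₅0.le; have g6 := g hR₆0.le
  have hX320 : 0 ≤ X ^ (3 / 2 : ℝ) := Real.rpow_nonneg hX0.le _
  have p1 : 0 ≤ X ^ (3 / 2 : ℝ) * R₁ := mul_nonneg hX320 hR₁0.le
  have p2 : 0 ≤ X ^ (3 / 2 : ℝ) * R₂ := mul_nonneg hX320 hR₂0.le
  have p6 : 0 ≤ X ^ (3 / 2 : ℝ) * R₆ := mul_nonneg hX320 hR₆0.le
  calc R₁ * L ^ (-(1 / 2) : ℝ) + A * M ^ 2 / (b * L * N) + M ^ 2 / L + R₂ * L ^ (-(1 / 2) : ℝ) +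
        b ^ (1 / 2 : ℝ) * A * L ^ (3 / 2 : ℝ) * N ^ (7 / 4 : ℝ) + b ^ (1 / 2 : ℝ) * A ^ (1 / 2 : ℝ) * M * N / L
      ≤ R₁ + R₃ + R₄ + R₂ + 8 * (R₃ + R₄ + R₅ + X ^ (3 / 2 : ℝ) * R₆) + R₅ := by
        linarith only [b1, b2, b3, b4, b5, b6]
    _ ≤ 9 * X ^ (3 / 2 : ℝ) * (R₁ + R₂ + R₃ + R₄ + R₅ + R₆) := by
        linarith only [g1, g2, g3, g4, g5, g6, p1, p2, p6]


set_option maxHeartbeats 400000 in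
/-- **From (5.1) for all admissible `L` to (5.2), general `A`, twisted** (Bettin–Chandee §5).
Suppose that for every `ε > 0` there is `K` such that for every squarefull `b ≥ 1`,
`M, N' ≥ 1/2` with `b ≤ N'`, `bN' ≤ M`, `A ≥ 1/2`, `ϑ ≠ 0` with `(b,ϑ) = 1`, real `η`, `γ` on
squarefree `N' < n ≤ 2N'` coprime to `bϑ`, `ν` on `(A,2A]`, and EVERY real `L ≥ 1` at least an
admissibility threshold `Lmin(b,M,N',A,ϑ,η)` of logarithmic size
(`≤ C(1 + log(1 + (1+|ϑ|+|η|)bMN'A))`; the source's "`L ≥ 2 log(bϑM)`"), the twisted trilinear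
`𝓒_b`-moment (in the native form of `TrilinearKloostermanFractionsFromCbTools.lean`) is at most
`K‖γ‖²‖ν‖² ((1+|ϑ|+|η|)bMN'A)^ε (1+(|ϑ|+|η|)A/(bN'M)) (AM(bN')^{1/2}L^{-1/2} + AM²/(bLN') + M²/L + b^{3/4}AM^{1/2}N'^{5/4}L^{-1/2} + b^{1/2}AL^{3/2}N'^{7/4} + b^{1/2}A^{1/2}MN'/L)`
((5.1) with (2.2) applied, general `A`, Remark 2's factor with exponent `1`).  Then (5.2) holds
in the form of the hypothesis `h52` of `BC_C1A_bound_of_CbA_bound`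
(`TrilinearKloostermanFractionsFromCb.lean`): choose
`L = M^{4/5}b^{-3/5}N'^{-11/10} + M^{4/5}b^{-1/5}A^{-2/5}N'^{-7/10} + M^{2/5}A^{-1/5}N'^{-3/10} + max(1, Lmin)`
(`BC_optimise_LA`); the factor `max(1, Lmin)^{3/2}` is `≪ ((1+|ϑ|+|η|)bMN'A)^{ε}`
(`DFI_log_threshold_le`). [cite: BettinChandee2018, §5] -/
theorem BC_CbA_bound_of_LA_bound (Lmin : ℕ → ℝ → ℝ → ℝ → ℤ → ℝ → ℝ)
    (hLmin : ∃ C : ℝ, 0 ≤ C ∧ ∀ (b : ℕ) (M N' A : ℝ) (ϑ : ℤ) (η : ℝ), 0 < b → 1 / 2 ≤ M →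
      1 / 2 ≤ N' → 1 / 2 ≤ A →
      Lmin b M N' A ϑ η ≤ C * (1 + Real.log (1 + (1 + |(ϑ : ℝ)| + |η|) * ((b : ℝ) * M * N' * A))))
    (h51 : ∀ ε : ℝ, 0 < ε → ∃ K : ℝ, 0 < K ∧ ∀ (b : ℕ), 0 < b → (∀ p ∈ b.primeFactors, p ^ 2 ∣ b) →
      ∀ (M N' A : ℝ), 1 / 2 ≤ M → 1 / 2 ≤ N' → (b : ℝ) ≤ N' → (b : ℝ) * N' ≤ M → 1 / 2 ≤ A →
      ∀ (ϑ : ℤ), ϑ ≠ 0 → b.Coprime ϑ.natAbs → ∀ (η : ℝ) (γ ν : ℕ → ℂ),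
        (∀ n : ℕ, γ n ≠ 0 → N' < n ∧ (n : ℝ) ≤ 2 * N') →
        (∀ n : ℕ, γ n ≠ 0 → Squarefree n ∧ n.Coprime b ∧ n.Coprime ϑ.natAbs) →
        (∀ a : ℕ, ν a ≠ 0 → A < a ∧ (a : ℝ) ≤ 2 * A) →
        ∀ L : ℝ, Lmin b M N' A ϑ η ≤ L → 1 ≤ L →
        ∑ m ∈ (Finset.Ioc ⌊M⌋₊ ⌊2 * M⌋₊).filter (fun m => m.Coprime b),
            ‖∑ n' ∈ (Finset.Icc 1 ⌊2 * N'⌋₊).filter (fun n' => n'.Coprime m),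
              γ n' * ∑ a ∈ Finset.Icc 1 ⌊2 * A⌋₊, ν a * Complex.exp (2 * Real.pi * Complex.I *
                ((ϑ : ℂ) * (a : ℂ) * ((((m : ZMod (b * n'))⁻¹).val : ℕ) : ℂ) / ((b * n' : ℕ) : ℂ) +
                  (η : ℂ) * (a : ℂ) / ((m : ℂ) * ((b * n' : ℕ) : ℂ))))‖ ^ 2 ≤
          K * (∑ n ∈ Finset.Icc 1 ⌊2 * N'⌋₊, ‖γ n‖ ^ 2) * (∑ a ∈ Finset.Icc 1 ⌊2 * A⌋₊, ‖ν a‖ ^ 2) *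
            ((1 + |(ϑ : ℝ)| + |η|) * ((b : ℝ) * M * N' * A)) ^ ε *
            (1 + (|(ϑ : ℝ)| + |η|) * A / ((b : ℝ) * N' * M)) *
            (A * M * ((b : ℝ) * N') ^ (1 / 2 : ℝ) * L ^ (-(1 / 2) : ℝ) + A * M ^ 2 / ((b : ℝ) * L * N') +
              M ^ 2 / L + (b : ℝ) ^ (3 / 4 : ℝ) * A * M ^ (1 / 2 : ℝ) * N' ^ (5 / 4 : ℝ) * L ^ (-(1 / 2) : ℝ) +
              (b : ℝ) ^ (1 / 2 : ℝ) * A * L ^ (3 / 2 : ℝ) * N' ^ (7 / 4 : ℝ) +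
              (b : ℝ) ^ (1 / 2 : ℝ) * A ^ (1 / 2 : ℝ) * M * N' / L)) :
    ∀ ε : ℝ, 0 < ε → ∃ K : ℝ, 0 < K ∧ ∀ (b : ℕ), 0 < b → (∀ p ∈ b.primeFactors, p ^ 2 ∣ b) →
      ∀ (M N' A : ℝ), 1 / 2 ≤ M → 1 / 2 ≤ N' → (b : ℝ) ≤ N' → (b : ℝ) * N' ≤ M → 1 / 2 ≤ A →
      ∀ (ϑ : ℤ), ϑ ≠ 0 → b.Coprime ϑ.natAbs → ∀ (η : ℝ) (γ ν : ℕ → ℂ),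
        (∀ n : ℕ, γ n ≠ 0 → N' < n ∧ (n : ℝ) ≤ 2 * N') →
        (∀ n : ℕ, γ n ≠ 0 → Squarefree n ∧ n.Coprime b ∧ n.Coprime ϑ.natAbs) →
        (∀ a : ℕ, ν a ≠ 0 → A < a ∧ (a : ℝ) ≤ 2 * A) →
        ∑ m ∈ (Finset.Ioc ⌊M⌋₊ ⌊2 * M⌋₊).filter (fun m => m.Coprime b),
            ‖∑ n' ∈ (Finset.Icc 1 ⌊2 * N'⌋₊).filter (fun n' => n'.Coprime m),
              γ n' * ∑ a ∈ Finset.Icc 1 ⌊2 * A⌋₊, ν a * Complex.exp (2 * Real.pi * Complex.I *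
                ((ϑ : ℂ) * (a : ℂ) * ((((m : ZMod (b * n'))⁻¹).val : ℕ) : ℂ) / ((b * n' : ℕ) : ℂ) +
                  (η : ℂ) * (a : ℂ) / ((m : ℂ) * ((b * n' : ℕ) : ℂ))))‖ ^ 2 ≤
          K * (∑ n ∈ Finset.Icc 1 ⌊2 * N'⌋₊, ‖γ n‖ ^ 2) * (∑ a ∈ Finset.Icc 1 ⌊2 * A⌋₊, ‖ν a‖ ^ 2) *
            ((1 + |(ϑ : ℝ)| + |η|) * ((b : ℝ) * M * N' * A)) ^ ε *
            (1 + (|(ϑ : ℝ)| + |η|) * A / ((b : ℝ) * N' * M)) *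
            (A * M * ((b : ℝ) * N') ^ (1 / 2 : ℝ) +
              (b : ℝ) ^ (3 / 4 : ℝ) * A * M ^ (1 / 2 : ℝ) * N' ^ (5 / 4 : ℝ) +
              A * M ^ (6 / 5 : ℝ) * N' ^ (1 / 10 : ℝ) * (b : ℝ) ^ (-(2 / 5) : ℝ) +
              (b : ℝ) ^ (1 / 5 : ℝ) * A ^ (2 / 5 : ℝ) * M ^ (6 / 5 : ℝ) * N' ^ (7 / 10 : ℝ) +
              A ^ (7 / 10 : ℝ) * (b : ℝ) ^ (1 / 2 : ℝ) * M ^ (3 / 5 : ℝ) * N' ^ (13 / 10 : ℝ) +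
              (b : ℝ) ^ (1 / 2 : ℝ) * A * N' ^ (7 / 4 : ℝ)) := by
  intro ε hε
  obtain ⟨C, hC0, hC⟩ := hLmin
  obtain ⟨K, hK, hB⟩ := h51 (ε / 2) (by positivity)
  -- `X^{3/2} ≤ D · x^{ε/2}` with `X = max 1 Lmin`, `x = (1+|ϑ|+|η|) bMN'A`; `δ = ε/3`, applied to `2x`
  set D : ℝ := ((1 + 2 * C + C / (ε / 3)) * (4 : ℝ) ^ (ε / 3)) ^ (3 / 2 : ℝ) with hD
  have hD0 : 0 < D := by positivity
  refine ⟨9 * D * K, by positivity, ?_⟩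
  intro b hb hbfull M N' A hM hN' hbN hbNM hA ϑ hϑ hbk η γ ν hγ hγ2 hν
  have hM0 : 0 < M := by linarith
  have hN0 : 0 < N' := by linarith
  have hA0 : 0 < A := by linarith
  have hbr : (0 : ℝ) < b := by exact_mod_cast hb
  set x : ℝ := (1 + |(ϑ : ℝ)| + |η|) * ((b : ℝ) * M * N' * A) with hx
  have hx0 : 0 < x := by positivity
  have hx14 : 1 / 4 ≤ x := by
    have hb1 : (1 : ℝ) ≤ b := by exact_mod_cast hb
    have hk2 : (2 : ℝ) ≤ 1 + |(ϑ : ℝ)| + |η| := by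
      have : (1 : ℝ) ≤ |(ϑ : ℝ)| := by rw [← Int.cast_abs]; exact_mod_cast Int.one_le_abs hϑ
      linarith [abs_nonneg η]
    have : (2 : ℝ) * (1 * (1 / 2) * (1 / 2) * (1 / 2)) ≤ (1 + |(ϑ : ℝ)| + |η|) * ((b : ℝ) * M * N' * A) := by
      gcongr
    rw [hx]; linarith
  -- the admissible `X` and `L`
  set X : ℝ := max 1 (Lmin b M N' A ϑ η) with hX
  have hX1 : 1 ≤ X := le_max_left _ _
  have hXL : Lmin b M N' A ϑ η ≤ X := le_max_right _ _
  set L : ℝ := M ^ (4 / 5 : ℝ) * (b : ℝ) ^ (-(3 / 5) : ℝ) * N' ^ (-(11 / 10) : ℝ) +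
    M ^ (4 / 5 : ℝ) * (b : ℝ) ^ (-(1 / 5) : ℝ) * A ^ (-(2 / 5) : ℝ) * N' ^ (-(7 / 10) : ℝ) +
    M ^ (2 / 5 : ℝ) * A ^ (-(1 / 5) : ℝ) * N' ^ (-(3 / 10) : ℝ) + X with hL
  have hpos1 : 0 < M ^ (4 / 5 : ℝ) * (b : ℝ) ^ (-(3 / 5) : ℝ) * N' ^ (-(11 / 10) : ℝ) := by positivity
  have hpos2 : 0 < M ^ (4 / 5 : ℝ) * (b : ℝ) ^ (-(1 / 5) : ℝ) * A ^ (-(2 / 5) : ℝ) * N' ^ (-(7 / 10) : ℝ) := by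
    positivity
  have hpos3 : 0 < M ^ (2 / 5 : ℝ) * A ^ (-(1 / 5) : ℝ) * N' ^ (-(3 / 10) : ℝ) := by positivity
  have hLX : X ≤ L := by rw [hL]; linarith
  have hL1 : 1 ≤ L := hX1.trans hLX
  have hLmin' : Lmin b M N' A ϑ η ≤ L := hXL.trans hLX
  have h := hB b hb hbfull M N' A hM hN' hbN hbNM hA ϑ hϑ hbk η γ ν hγ hγ2 hν L hLmin' hL1
  clear hB
  have hopt := BC_optimise_LA (M := M) (N := N') (b := (b : ℝ)) (A := A) hM0 hN0 hbr hA0 hX1 hL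
  -- `X^{3/2} ≤ D x^{ε/2}`
  have hX32 : X ^ (3 / 2 : ℝ) ≤ D * x ^ (ε / 2) := by
    have h1 : X ≤ 1 + C * (1 + Real.log (1 + 2 * x)) := by
      refine max_le ?_ ?_
      · have : 0 ≤ C * (1 + Real.log (1 + 2 * x)) := by
          have : 0 ≤ Real.log (1 + 2 * x) := Real.log_nonneg (by linarith)
          positivity
        linarith
      · have h2 := hC b M N' A ϑ η hb hM hN' hA
        rw [← hx] at h2
        have h3 : Real.log (1 + x) ≤ Real.log (1 + 2 * x) :=
          Real.log_le_log (by linarith) (by linarith)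
        have h4 : C * (1 + Real.log (1 + x)) ≤ C * (1 + Real.log (1 + 2 * x)) :=
          mul_le_mul_of_nonneg_left (by linarith) hC0
        linarith
    have hx12 : 1 / 2 ≤ 2 * x := by linarith
    have h2 := DFI_log_threshold_le hx12 (show (0 : ℝ) < ε / 3 by positivity) hC0
    have h3 : X ≤ (1 + 2 * C + C / (ε / 3)) * (2 * (2 * x)) ^ (ε / 3) := h1.trans h2
    have h4 : X ^ (3 / 2 : ℝ) ≤ ((1 + 2 * C + C / (ε / 3)) * (2 * (2 * x)) ^ (ε / 3)) ^ (3 / 2 : ℝ) :=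
      Real.rpow_le_rpow (by linarith) h3 (by norm_num)
    have h5 : ((1 + 2 * C + C / (ε / 3)) * (2 * (2 * x)) ^ (ε / 3)) ^ (3 / 2 : ℝ) = D * x ^ (ε / 2) := by
      rw [show (2 : ℝ) * (2 * x) = 4 * x by ring, Real.mul_rpow (by norm_num) hx0.le, ← mul_assoc,
        Real.mul_rpow (by positivity) (by positivity), ← Real.rpow_mul hx0.le,
        show ε / 3 * (3 / 2 : ℝ) = ε / 2 by ring, hD]
    rw [← h5]; exact h4
  -- assemble
  set nγ : ℝ := ∑ n ∈ Finset.Icc 1 ⌊2 * N'⌋₊, ‖γ n‖ ^ 2 with hnγ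
  have hnγ0 : 0 ≤ nγ := Finset.sum_nonneg fun _ _ => sq_nonneg _
  set nν : ℝ := ∑ a ∈ Finset.Icc 1 ⌊2 * A⌋₊, ‖ν a‖ ^ 2 with hnν
  have hnν0 : 0 ≤ nν := Finset.sum_nonneg fun _ _ => sq_nonneg _
  set W : ℝ := 1 + (|(ϑ : ℝ)| + |η|) * A / ((b : ℝ) * N' * M) with hW
  have hW0 : 0 ≤ W := by
    have : 0 ≤ (|(ϑ : ℝ)| + |η|) * A / ((b : ℝ) * N' * M) := by positivity
    rw [hW]; linarith
  set T52 : ℝ := A * M * ((b : ℝ) * N') ^ (1 / 2 : ℝ) +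
    (b : ℝ) ^ (3 / 4 : ℝ) * A * M ^ (1 / 2 : ℝ) * N' ^ (5 / 4 : ℝ) +
    A * M ^ (6 / 5 : ℝ) * N' ^ (1 / 10 : ℝ) * (b : ℝ) ^ (-(2 / 5) : ℝ) +
    (b : ℝ) ^ (1 / 5 : ℝ) * A ^ (2 / 5 : ℝ) * M ^ (6 / 5 : ℝ) * N' ^ (7 / 10 : ℝ) +
    A ^ (7 / 10 : ℝ) * (b : ℝ) ^ (1 / 2 : ℝ) * M ^ (3 / 5 : ℝ) * N' ^ (13 / 10 : ℝ) +
    (b : ℝ) ^ (1 / 2 : ℝ) * A * N' ^ (7 / 4 : ℝ) with hT52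
  have hT520 : 0 ≤ T52 := by positivity
  have hxε : x ^ (ε / 2) * x ^ (ε / 2) = x ^ ε := by rw [← Real.rpow_add hx0]; ring_nf
  calc _ ≤ K * nγ * nν * x ^ (ε / 2) * W *
        (A * M * ((b : ℝ) * N') ^ (1 / 2 : ℝ) * L ^ (-(1 / 2) : ℝ) + A * M ^ 2 / ((b : ℝ) * L * N') +
          M ^ 2 / L + (b : ℝ) ^ (3 / 4 : ℝ) * A * M ^ (1 / 2 : ℝ) * N' ^ (5 / 4 : ℝ) * L ^ (-(1 / 2) : ℝ) +
          (b : ℝ) ^ (1 / 2 : ℝ) * A * L ^ (3 / 2 : ℝ) * N' ^ (7 / 4 : ℝ) +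
          (b : ℝ) ^ (1 / 2 : ℝ) * A ^ (1 / 2 : ℝ) * M * N' / L) := h
    _ ≤ K * nγ * nν * x ^ (ε / 2) * W * (9 * X ^ (3 / 2 : ℝ) * T52) := by gcongr
    _ ≤ K * nγ * nν * x ^ (ε / 2) * W * (9 * (D * x ^ (ε / 2)) * T52) := by gcongr
    _ = 9 * D * K * nγ * nν * (x ^ (ε / 2) * x ^ (ε / 2)) * W * T52 := by ring
    _ = 9 * D * K * nγ * nν * x ^ ε * W * T52 := by rw [hxε]

end Literature.NumberTheory.LFunctions

end
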